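import Summits.ResolutionOfSingularities.ResolutionOfSingularities.Theorems.WeightedInvariantOrderHasseZariskiNagata
import Literature.AlgebraicGeometry.Resolution.TaylorOrderBound
import Mathlib.Topology.LocallyClosed
import HarnessLib

/-!
# Exact order, boundedness and the maximum locus at every prime of affine space over a perfect field

Route `ResolutionOfSingularities/WeightedInvariant`, door crux `Theses.WeightedInvariant.HypersurfaceCentreConstruction`
(stmt-ResolutionOfSingularities-19897), door line `local-engine`, H2a‴ clause (c8) at `ι = ord` — companion of
`WeightedInvariantOrderHasseZariskiNagata.lean` (ORDER (o15) of `res-L1-w43-plan-1`; res-type-078 after-care).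
Def-free helper lemmas (`--supports stmt-ResolutionOfSingularities-19897`); pure commutative algebra; no statement of
H. Hironaka's 2017 manuscript is typed or used and nothing here is a claim about resolution of singularities.
AI-written; weaker than expert review.

`K` PERFECT, `A = K[x_i : i ∈ σ]` (`σ : Type` finite), `f ∈ A`, `𝔭` ANY prime (closed or not), `D^{(β)} = hasseDeriv K β`:

* `algebraMap_mem_pow_and_not_mem_pow_succ_iff_hasseDeriv` — EXACT order at every prime:
  `f/1 ∈ 𝔪_{A_𝔭}^N ∖ 𝔪_{A_𝔭}^{N+1} ⟺ (∀ |β| < N, D^{(β)} f ∈ 𝔭) ∧ (∃ |β| = N, D^{(β)} f ∉ 𝔭)`;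
  `setOf_exactOrder_eq_zeroLocus_diff` / `isLocallyClosed_setOf_exactOrder` — the stratum `{ord_𝔭 f = N}` is
  `V(D^{(β)} f : |β| < N) ∖ V(D^{(β)} f : |β| = N)`, locally closed (open in `{ord ≥ N}`);
* `algebraMap_not_mem_maximalIdeal_pow_of_totalDegree_lt` (any field; port of the tree's `TaylorOrderBound`) /
  `exists_hasseDeriv_not_mem` / `ord_le_totalDegree_of_forall_iff` — the order of `f ≠ 0` is `≤ deg f` at EVERY prime;
* `exists_mem_forall_ord_le_of_forall_iff` / `isClosed_setOf_ord_eq_of_forall_le` — for `f ≠ 0` an order function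
  `ord : Spec A → ℕ∞` (`n ≤ ord 𝔭 ⟺ f/1 ∈ 𝔪_{A_𝔭}^n`) attains its maximum on every non-empty set of primes, and the
  locus of maximal order is CLOSED (the [S1]-shape «max locus closed and non-empty» for `ι = ord` on `𝔸ⁿ`).

References: [EGAIV4] ÉGA IV₄ §16.8, Thm. 16.11.2, §17.6; [VillamayorU2008ReesDiff] O. Villamayor U., Rev. Mat.
Iberoam. 24 (2008), §4.1, Remark 4.3; [CossartPiltant2008] V. Cossart, O. Piltant, J. Algebra 320 (2008), proof of
Prop. 4.2 ((11): `ord ≤ deg`; "`Σ := {x | m(x) = μ}` is a closed subset").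
-/

set_option linter.dupNamespace false -- mandated namespace of this single-conjunct summit

noncomputable section

namespace Summit.ResolutionOfSingularities.ResolutionOfSingularities.Theorems

open IsLocalRing MvPolynomial Finsupp
open Literature.AlgebraicGeometry.Resolution

universe u

/-! ## Exact order, boundedness and the maximum locus at every prime
-/

section ExactOrder

variable (K : Type u) [Field K] {σ : Type} [Fintype σ] [DecidableEq σ]

/-- **Exact order at every prime by derivatives** (`K` perfect, `𝔭 ⊂ K[x_σ]` any prime, `O = A_𝔭`):
`f/1 ∈ 𝔪_O^N ∖ 𝔪_O^{N+1} ⟺ (∀ |β| < N, D^{(β)} f ∈ 𝔭) ∧ (∃ |β| = N, D^{(β)} f ∉ 𝔭)` — the every-prime form of the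
tree's `mem_pow_and_not_mem_pow_succ_iff_of_hasseSchmidt` (maximal ideals). [cite: EGAIV4, Thm. 16.11.2 and §17.6]
[cite: VillamayorU2008ReesDiff, §4.1 and Remark 4.3] -/
theorem algebraMap_mem_pow_and_not_mem_pow_succ_iff_hasseDeriv [PerfectField K]
    (𝔭 : Ideal (MvPolynomial σ K)) [𝔭.IsPrime] (O : Type*) [CommRing O] [Algebra (MvPolynomial σ K) O]
    [IsLocalization.AtPrime O 𝔭] [IsLocalRing O] (N : ℕ) (f : MvPolynomial σ K) :
    (algebraMap (MvPolynomial σ K) O f ∈ maximalIdeal O ^ N ∧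
        algebraMap (MvPolynomial σ K) O f ∉ maximalIdeal O ^ (N + 1)) ↔
      (∀ β : σ →₀ ℕ, degree β < N → hasseDeriv K β f ∈ 𝔭) ∧
        ∃ β : σ →₀ ℕ, degree β = N ∧ hasseDeriv K β f ∉ 𝔭 := by
  rw [algebraMap_mem_maximalIdeal_pow_iff_forall_hasseDeriv_mem K 𝔭 O N f,
    algebraMap_mem_maximalIdeal_pow_iff_forall_hasseDeriv_mem K 𝔭 O (N + 1) f]
  constructor
  · rintro ⟨hlt, hnot⟩
    refine ⟨hlt, ?_⟩
    by_contra hne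
    push Not at hne
    exact hnot fun β hβ => (Nat.lt_succ_iff_lt_or_eq.mp hβ).elim (hlt β) (hne β)
  · rintro ⟨hlt, β, hβN, hβ⟩
    exact ⟨hlt, fun hall => hβ (hall β (by omega))⟩

/-- **The exact-order stratum is a difference of two zero sets**: `{𝔭 : ord_𝔭 f = N} =
V(D^{(β)} f : |β| < N) ∖ V(D^{(β)} f : |β| = N)` in `Spec K[x_σ]` (`K` perfect).
[cite: VillamayorU2008ReesDiff, §4.1 and Remark 4.3] -/
theorem setOf_exactOrder_eq_zeroLocus_diff [PerfectField K] (N : ℕ) (f : MvPolynomial σ K) :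
    {𝔭 : PrimeSpectrum (MvPolynomial σ K) |
        algebraMap (MvPolynomial σ K) (Localization.AtPrime 𝔭.asIdeal) f ∈
            maximalIdeal (Localization.AtPrime 𝔭.asIdeal) ^ N ∧
          algebraMap (MvPolynomial σ K) (Localization.AtPrime 𝔭.asIdeal) f ∉
            maximalIdeal (Localization.AtPrime 𝔭.asIdeal) ^ (N + 1)} =
      PrimeSpectrum.zeroLocus ((fun β : σ →₀ ℕ => hasseDeriv K β f) '' {β | degree β < N}) \
        PrimeSpectrum.zeroLocus ((fun β : σ →₀ ℕ => hasseDeriv K β f) '' {β | degree β = N}) := by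
  ext 𝔭
  rw [Set.mem_setOf_eq, algebraMap_mem_pow_and_not_mem_pow_succ_iff_hasseDeriv K 𝔭.asIdeal _ N f, Set.mem_sdiff,
    PrimeSpectrum.mem_zeroLocus, PrimeSpectrum.mem_zeroLocus, Set.image_subset_iff, Set.image_subset_iff]
  refine and_congr Iff.rfl ?_
  constructor
  · rintro ⟨β, hβN, hβ⟩ hsub
    exact hβ (hsub (Set.mem_setOf.mpr hβN))
  · intro h
    by_contra hne
    push Not at hne
    exact h fun β hβ => hne β hβ

/-- **The exact-order stratum `{ord_𝔭 f = N}` is locally closed** in `Spec K[x_σ]` (`K` perfect): open in the closed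
stratum `{ord ≥ N}`. [cite: VillamayorU2008ReesDiff, §4.1 and Remark 4.3] -/
theorem isLocallyClosed_setOf_exactOrder [PerfectField K] (N : ℕ) (f : MvPolynomial σ K) :
    IsLocallyClosed {𝔭 : PrimeSpectrum (MvPolynomial σ K) |
        algebraMap (MvPolynomial σ K) (Localization.AtPrime 𝔭.asIdeal) f ∈
            maximalIdeal (Localization.AtPrime 𝔭.asIdeal) ^ N ∧
          algebraMap (MvPolynomial σ K) (Localization.AtPrime 𝔭.asIdeal) f ∉
            maximalIdeal (Localization.AtPrime 𝔭.asIdeal) ^ (N + 1)} := by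
  rw [setOf_exactOrder_eq_zeroLocus_diff K N f, Set.sdiff_eq]
  exact (PrimeSpectrum.isClosed_zeroLocus _).isLocallyClosed.inter
    (PrimeSpectrum.isClosed_zeroLocus _).isOpen_compl.isLocallyClosed

omit [Fintype σ] [DecidableEq σ] in
/-- **The order is bounded by the degree at every prime** (any field; tree `TaylorOrderBound`): for `f ≠ 0` and
`N > deg f`, `f/1 ∉ 𝔪_{A_𝔭}^N`. [cite: CossartPiltant2008, Prop. 4.2 (proof, (11): ord ≤ deg)] -/
theorem algebraMap_not_mem_maximalIdeal_pow_of_totalDegree_lt (𝔭 : Ideal (MvPolynomial σ K)) [𝔭.IsPrime]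
    (O : Type*) [CommRing O] [Algebra (MvPolynomial σ K) O] [IsLocalization.AtPrime O 𝔭] [IsLocalRing O]
    {f : MvPolynomial σ K} (hf : f ≠ 0) {N : ℕ} (hN : f.totalDegree < N) :
    algebraMap (MvPolynomial σ K) O f ∉ maximalIdeal O ^ N :=
  algebraMap_mvPolynomial_not_mem_maximalIdeal_pow 𝔭 O hf hN

/-- Hence, for `f ≠ 0` over a perfect field, SOME Hasse–Schmidt derivative of order `≤ deg f` of `f` lies outside
every prime `𝔭` (indeed the top ones are the non-zero top coefficients). [cite: EGAIV4, Thm. 16.11.2] -/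
theorem exists_hasseDeriv_not_mem [PerfectField K] (𝔭 : Ideal (MvPolynomial σ K)) [𝔭.IsPrime]
    {f : MvPolynomial σ K} (hf : f ≠ 0) :
    ∃ β : σ →₀ ℕ, degree β ≤ f.totalDegree ∧ hasseDeriv K β f ∉ 𝔭 := by
  by_contra hne
  push Not at hne
  exact algebraMap_not_mem_maximalIdeal_pow_of_totalDegree_lt K 𝔭 (Localization.AtPrime 𝔭) hf
    (Nat.lt_succ_self _)
    ((algebraMap_mem_maximalIdeal_pow_iff_forall_hasseDeriv_mem K 𝔭 (Localization.AtPrime 𝔭) _ f).mpr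
      fun β hβ => hne β (by omega))

omit [Fintype σ] [DecidableEq σ] in
/-- **Boundedness, order-function form**: any `ℕ∞`-valued `ord` on `Spec K[x_σ]` reading the powers of the maximal
ideals (`n ≤ ord 𝔭 ⟺ f/1 ∈ 𝔪_{A_𝔭}^n`) satisfies `ord 𝔭 ≤ deg f` everywhere when `f ≠ 0` (any field).
[cite: CossartPiltant2008, Prop. 4.2 (proof, (11): ord ≤ deg)] -/
theorem ord_le_totalDegree_of_forall_iff (f : MvPolynomial σ K) (hf : f ≠ 0)
    (ord : PrimeSpectrum (MvPolynomial σ K) → ℕ∞)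
    (hord : ∀ (𝔭 : PrimeSpectrum (MvPolynomial σ K)) (n : ℕ), (n : ℕ∞) ≤ ord 𝔭 ↔
      algebraMap (MvPolynomial σ K) (Localization.AtPrime 𝔭.asIdeal) f ∈
        maximalIdeal (Localization.AtPrime 𝔭.asIdeal) ^ n)
    (𝔭 : PrimeSpectrum (MvPolynomial σ K)) : ord 𝔭 ≤ (f.totalDegree : ℕ∞) := by
  by_contra hlt
  push Not at hlt
  have h1 : ((f.totalDegree + 1 : ℕ) : ℕ∞) ≤ ord 𝔭 := by
    rw [Nat.cast_add, Nat.cast_one]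
    exact Order.add_one_le_of_lt hlt
  exact algebraMap_not_mem_maximalIdeal_pow_of_totalDegree_lt K 𝔭.asIdeal (Localization.AtPrime 𝔭.asIdeal) hf
    (Nat.lt_succ_self _) ((hord 𝔭 _).mp h1)

omit [Fintype σ] [DecidableEq σ] in
/-- **The maximum of the order is attained** (`f ≠ 0`): on every non-empty set `Z` of primes there is a point where an
order function `ord` as above is maximal (its values on `Z` are bounded by `deg f`). [cite: CossartPiltant2008,
Prop. 4.2 (proof: "let μ := sup m(x) … Σ := {x | m(x) = μ}")] -/
theorem exists_mem_forall_ord_le_of_forall_iff (f : MvPolynomial σ K) (hf : f ≠ 0)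
    (ord : PrimeSpectrum (MvPolynomial σ K) → ℕ∞)
    (hord : ∀ (𝔭 : PrimeSpectrum (MvPolynomial σ K)) (n : ℕ), (n : ℕ∞) ≤ ord 𝔭 ↔
      algebraMap (MvPolynomial σ K) (Localization.AtPrime 𝔭.asIdeal) f ∈
        maximalIdeal (Localization.AtPrime 𝔭.asIdeal) ^ n)
    {Z : Set (PrimeSpectrum (MvPolynomial σ K))} (hZ : Z.Nonempty) :
    ∃ 𝔭₀ ∈ Z, ∀ 𝔭 ∈ Z, ord 𝔭 ≤ ord 𝔭₀ := by
  classical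
  -- the values of `ord` on `Z` are naturals `≤ deg f`; take the largest one that occurs
  have hfin : ∀ 𝔭, ∃ m : ℕ, ord 𝔭 = m ∧ m ≤ f.totalDegree := fun 𝔭 => by
    have hle := ord_le_totalDegree_of_forall_iff K f hf ord hord 𝔭
    have hne : ord 𝔭 ≠ ⊤ := ne_top_of_le_ne_top (ENat.coe_ne_top _) hle
    obtain ⟨m, hm⟩ := ENat.ne_top_iff_exists.mp hne
    exact ⟨m, hm.symm, by rw [← hm] at hle; exact_mod_cast hle⟩
  let vals : Finset ℕ := (Finset.range (f.totalDegree + 1)).filter fun m => ∃ 𝔭 ∈ Z, ord 𝔭 = m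
  obtain ⟨𝔮, h𝔮⟩ := hZ
  have hvals : vals.Nonempty := by
    obtain ⟨m, hm, hmle⟩ := hfin 𝔮
    exact ⟨m, Finset.mem_filter.mpr ⟨Finset.mem_range.mpr (by omega), 𝔮, h𝔮, hm⟩⟩
  obtain ⟨𝔭₀, h𝔭₀Z, h𝔭₀⟩ := (Finset.mem_filter.mp (Finset.max'_mem vals hvals)).2
  refine ⟨𝔭₀, h𝔭₀Z, fun 𝔭 h𝔭 => ?_⟩
  obtain ⟨m, hm, hmle⟩ := hfin 𝔭
  have hmv : m ∈ vals := Finset.mem_filter.mpr ⟨Finset.mem_range.mpr (by omega), 𝔭, h𝔭, hm⟩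
  rw [hm, h𝔭₀]
  exact_mod_cast Finset.le_max' vals m hmv

/-- **The maximum locus is closed** (`K` perfect): if `μ` bounds an order function `ord` as above on ALL of
`Spec K[x_σ]`, then `{𝔭 | ord 𝔭 = μ} = {𝔭 | μ ≤ ord 𝔭}` is closed (upper semicontinuity). With
`exists_mem_forall_ord_le_of_forall_iff` (`Z = univ`): the locus of maximal order of a non-zero `f` is a non-empty closed
subset of affine space — the [S1]-shape «max locus closed, non-empty» for `ι = ord` on `𝔸ⁿ`. [cite: CossartPiltant2008,
Prop. 4.2 (proof: "Σ is a closed subset of X")] -/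
theorem isClosed_setOf_ord_eq_of_forall_le [PerfectField K] (f : MvPolynomial σ K)
    (ord : PrimeSpectrum (MvPolynomial σ K) → ℕ∞)
    (hord : ∀ (𝔭 : PrimeSpectrum (MvPolynomial σ K)) (n : ℕ), (n : ℕ∞) ≤ ord 𝔭 ↔
      algebraMap (MvPolynomial σ K) (Localization.AtPrime 𝔭.asIdeal) f ∈
        maximalIdeal (Localization.AtPrime 𝔭.asIdeal) ^ n)
    {μ : ℕ∞} (hμ : ∀ 𝔭, ord 𝔭 ≤ μ) :
    IsClosed {𝔭 : PrimeSpectrum (MvPolynomial σ K) | ord 𝔭 = μ} := by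
  have : {𝔭 : PrimeSpectrum (MvPolynomial σ K) | ord 𝔭 = μ} = {𝔭 | μ ≤ ord 𝔭} := by
    ext 𝔭
    exact ⟨fun h => h.ge, fun h => le_antisymm (hμ 𝔭) h⟩
  rw [this]
  exact isClosed_setOf_le_of_forall_iff K f ord hord μ

end ExactOrder

end Summit.ResolutionOfSingularities.ResolutionOfSingularities.Theorems

end
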